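import Summits.QuantumFields.YangMills.Theses.SqueezedSkewness

/-!
# Birth skeleton for `SqueezedSkewness.SpectralIdentificationL` (item stmt-QuantumFields-22796)

Planner ym-idea-6 g8 (LINE 2 «low-pass floor»).  Two registered stubs and the kernel-checked composition
`SpectralIdentificationL_of : stub_osData-statement → stub_jointDiagonal-statement → SpectralIdentificationL`.

* `stub_osData` (L): the Osterwalder–Schrader / transfer-operator data of the site-reflection on the finite spatial
  torus, realised on `ℓ²(ℕ, ℂ)` (any separable Hilbert space embeds; extend `P` by `0` and `U` by `1` on the
  complement): a positive self-adjoint compact contraction `P` (the ground-state-transformed one-step transfer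
  operator on `Ω^⊥`), a unitary representation `U` of `ℤ³` factoring through `(ℤ/S)³`, commuting with `P`, and ONE
  vector `ψ₀ = [A_(1,0⃗)]` such that the thermal limit of the route's reflection form is
  `lim_k Qrp_k(f) = ‖Σ_x f(sx) P^(x₀−1) U(x⃗) ψ₀‖²` for every compact-height test function inside the open spatial
  fundamental cube (Markov property = site RP; time-homogeneity gives the covariance identity, electric plaquettes
  included; thermal limit via `Theorems/SqueezedSkewnessThermalLimitSpectralSums.lean`).
* `stub_jointDiagonal` (M): pure operator theory — such data admit a joint orthonormal eigenbasis
  (`P e_n = μ_n e_n`, `U(z⃗) e_n = e^(2πi q_n·z⃗/S) e_n`), and Parseval gives the `HasSum` with `W_n = |⟪e_n, ψ₀⟫|²`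
  for every finitely supported coefficient family vanishing at heights `x₀ ≤ 0`.
No summit / NT statement is proved here. -/

set_option autoImplicit false

namespace Summit.QuantumFields.YangMills.Cruxes.NT.SpectralIdentificationLBirth

open Summit.QuantumFields.YangMills.Theses.SqueezedSkewness

/-! ## Name-keyed statements of the two registered stubs -/
namespace __Registered

/-- Statement of `stub_osData` (L): OS / transfer-operator data on ℓ²(ℕ) with the thermal-limit covariance identity. -/
abbrev stub_osData : Prop :=
  ∀ (G : Type) [Group G] [TopologicalSpace G] [IsTopologicalGroup G] [CompactSpace G], letI : MeasurableSpace G := borel G; haveI : BorelSpace G := ⟨rfl⟩; ∀ (r : Literature.MathematicalPhysics.QuantumFieldTheory.LatticeRep G), let St : ℕ → ℕ → Type := fun S T => Literature.MathematicalPhysics.QuantumFieldTheory.FinTorusSite S S S T; let Cfg : ℕ → ℕ → Type := fun S T => Literature.MathematicalPhysics.QuantumFieldTheory.FinTorusSite S S S T × Fin 4 → G; let cc : (n : ℕ) → Fin n → ℤ := fun n i => if 2 * i.val < n then (i.val : ℤ) else (i.val : ℤ) - n; let posE : (S T : ℕ) → St S T → EuclideanSpace ℝ (Fin 4) := fun S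 T x => Literature.MathematicalPhysics.QuantumLattice.siteToE (d := 4) ![cc T x.2.2.2, cc S x.1, cc S x.2.1, cc S x.2.2.1]; let P : (S T : ℕ) → St S T → Fin 4 → Fin 4 → Cfg S T → ℝ := fun _ _ x i j U => (r.ρ (Literature.MathematicalPhysics.QuantumFieldTheory.finTorusPlaquette U x i j)).trace.re; let A : (S T : ℕ) → St S T → Cfg S T → ℝ := fun S T x U => ∑ q : {q : Fin 4 × Fin 4 // q.1 < q.2}, P S T x q.1.1 q.1.2 U; let w : ℝ → (S T : ℕ) → Cfg S T → ℝ := fun β S T U => Real.exp (-β * ∑ x : St S T, ∑ q : {q : Fin 4 × Fin 4 // q.1 < q.2}, ((r.N : ℝ) - P S T x q.1.1 q.1.2 U)); let E : ℝ → (S T : ℕ) → (Cfg S T → ℝ) → ℝ := fun β S T F => (∫ U : Literature.MathematicalPhysics.QuantumFieldTheory.FinTorusSite S S S T × Fin 4 → G, F U * w β S T U ∂MeasureTheory.Measure.pi (fun _ => Literature.MathematicalPhysics.QuantumFieldTheory.haarProbability G)) / Literature.MathematicalPhysics.QuantumFieldTheory.wilsonFinTorusPartition r.ρ β S S S T; let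 Cov : ℝ → (S T : ℕ) → (Cfg S T → ℝ) → (Cfg S T → ℝ) → ℝ := fun β S T F F' => E β S T (fun U => F U * F' U) - E β S T F * E β S T F'; let refl : (S T : ℕ) → Cfg S T → Cfg S T := fun _ T U e => if e.2 = Fin.last 3 then (U ((e.1.1, e.1.2.1, e.1.2.2.1, Fin.rev e.1.2.2.2), Fin.last 3))⁻¹ else U ((e.1.1, e.1.2.1, e.1.2.2.1, ⟨(T - e.1.2.2.2.val) % T, Nat.mod_lt _ e.1.2.2.2.pos⟩), e.2); let B : (S T : ℕ) → ℝ → SchwartzMap (EuclideanSpace ℝ (Fin 4)) ℝ → Cfg S T → ℝ := fun S T s f U => ∑ x : St S T, f (s • posE S T x) * A S T x U; let Qrp : ℝ → (S T : ℕ) → ℝ → SchwartzMap (EuclideanSpace ℝ (Fin 4)) ℝ → ℝ := fun β S T s f => Cov β S T (fun U => B S T s f (refl S T U)) (B S T s f); ∀ (β : ℝ) (L : ℕ) (s : ℝ), 0 ≤ β → 1 ≤ L → 0 < s → ∃ (P : lp (fun _ : ℕ => ℂ) 2 →L[ℂ] lp (fun _ : ℕ => ℂ) 2) (U : (Fin 3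 → ℤ) → (lp (fun _ : ℕ => ℂ) 2 →L[ℂ] lp (fun _ : ℕ => ℂ) 2)) (ψ₀ : lp (fun _ : ℕ => ℂ) 2), (IsSelfAdjoint P ∧ IsCompactOperator P ∧ ‖P‖ ≤ 1 ∧ (∀ v : lp (fun _ : ℕ => ℂ) 2, 0 ≤ RCLike.re (inner ℂ (P v) v)) ∧ U 0 = 1 ∧ (∀ x y : Fin 3 → ℤ, U (x + y) = U x * U y) ∧ (∀ x y : Fin 3 → ℤ, (∀ i, ((x i : ℤ) : ZMod (2 * L + 1)) = ((y i : ℤ) : ZMod (2 * L + 1))) → U x = U y) ∧ (∀ (x : Fin 3 → ℤ) (v : lp (fun _ : ℕ => ℂ) 2), ‖U x v‖ = ‖v‖) ∧ (∀ x : Fin 3 → ℤ, P * U x = U x * P)) ∧ ∀ (H : ℝ) (f : SchwartzMap (EuclideanSpace ℝ (Fin 4)) ℝ), tsupport (f : EuclideanSpace ℝ (Fin 4) → ℝ) ⊆ {y : EuclideanSpace ℝ (Fin 4) | 0 < y 0 ∧ y 0 ≤ H} → tsupport (f : EuclideanSpace ℝ (Fin 4) → ℝ) ⊆ {y : EuclideanSpace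 ℝ (Fin 4) | ∀ i : Fin 3, |y i.succ| < s * (L + 1 / 2)} → Filter.Tendsto (fun k : ℕ => Qrp β (2 * L + 1) (2 ^ k * (2 * L + 1)) s f) Filter.atTop (nhds (‖(∑' x : Fin 4 → ℤ, ((f (s • Literature.MathematicalPhysics.QuantumLattice.siteToE (d := 4) x) : ℝ) : ℂ) • ((P ^ (Int.toNat (x 0 - 1))) ((U (fun i : Fin 3 => x i.succ)) ψ₀)))‖ ^ 2))

/-- Statement of `stub_jointDiagonal` (M): joint diagonalisation of (P, U) and Parseval ⇒ the Källén–Lehmann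
`HasSum` with reciprocal-lattice momenta, for every admissible test function. -/
abbrev stub_jointDiagonal : Prop :=
  ∀ (L : ℕ) (s : ℝ), 1 ≤ L → 0 < s → ∀ (P : lp (fun _ : ℕ => ℂ) 2 →L[ℂ] lp (fun _ : ℕ => ℂ) 2) (U : (Fin 3 → ℤ) → (lp (fun _ : ℕ => ℂ) 2 →L[ℂ] lp (fun _ : ℕ => ℂ) 2)) (ψ₀ : lp (fun _ : ℕ => ℂ) 2), IsSelfAdjoint P ∧ IsCompactOperator P ∧ ‖P‖ ≤ 1 ∧ (∀ v : lp (fun _ : ℕ => ℂ) 2, 0 ≤ RCLike.re (inner ℂ (P v) v)) ∧ U 0 = 1 ∧ (∀ x y : Fin 3 → ℤ, U (x + y) = U x * U y) ∧ (∀ x y : Fin 3 → ℤ, (∀ i, ((x i : ℤ) : ZMod (2 * L + 1)) = ((y i : ℤ) : ZMod (2 * L + 1))) → U x = U y) ∧ (∀ (x : Fin 3 → ℤ) (v : lp (fun _ : ℕ => ℂ) 2), ‖U x v‖ = ‖v‖) ∧ (∀ x : Fin 3 → ℤ, P * U x = U x * P) → ∃ (W μ : ℕ → ℝ) (q : ℕ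 → Fin 3 → ℤ), (∀ n, 0 ≤ W n) ∧ (∀ n, 0 ≤ μ n ∧ μ n ≤ 1) ∧ ∀ (H : ℝ) (f : SchwartzMap (EuclideanSpace ℝ (Fin 4)) ℝ), tsupport (f : EuclideanSpace ℝ (Fin 4) → ℝ) ⊆ {y : EuclideanSpace ℝ (Fin 4) | 0 < y 0 ∧ y 0 ≤ H} → tsupport (f : EuclideanSpace ℝ (Fin 4) → ℝ) ⊆ {y : EuclideanSpace ℝ (Fin 4) | ∀ i : Fin 3, |y i.succ| < s * (L + 1 / 2)} → HasSum (fun n : ℕ => W n * ‖(∑' x : Fin 4 → ℤ, (((f (s • Literature.MathematicalPhysics.QuantumLattice.siteToE (d := 4) x) * μ n ^ (Int.toNat (x 0 - 1))) : ℝ) : ℂ) * Complex.exp (Complex.I * ((s * ∑ k : Fin 3, (2 * Real.pi * (q n k : ℝ) / (s * (2 * L + 1))) * (x k.succ : ℝ) : ℝ) : ℂ)))‖ ^ 2) (‖(∑' x : Fin 4 → ℤ, ((f (s • Literature.MathematicalPhysics.QuantumLattice.siteToE (d := 4) x) : ℝ) : ℂ) • ((P ^ (Int.toNat (x 0 - 1)))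 ((U (fun i : Fin 3 => x i.succ)) ψ₀)))‖ ^ 2)

end __Registered

/-! ## The two registered stubs — the ONLY `sorry`s of this file -/

/-- stub (L): OS / transfer-operator data.  OPEN. -/
theorem stub_osData : __Registered.stub_osData := by
  sorry

/-- stub (M): joint diagonalisation + Parseval.  OPEN (pure operator theory + finite lattice support). -/
theorem stub_jointDiagonal : __Registered.stub_jointDiagonal := by
  sorry

/-! ## Composition: the crux BY NAME from the two stub statements (no `sorry` below) -/

/-- **SpectralIdentificationL_of** — conclusion = the route decl
`Summit.QuantumFields.YangMills.Theses.SqueezedSkewness.SpectralIdentificationL`, by name. -/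
theorem SpectralIdentificationL_of (h1 : __Registered.stub_osData)
    (h2 : __Registered.stub_jointDiagonal) :
    SpectralIdentificationL := by
  intro G _ _ _ _ r St Cfg cc posE Pl A w E Cov refl B Qrp amp β L s hβ hL hs
  obtain ⟨P', U, ψ₀, hprops, hlim⟩ := h1 G r β L s hβ hL hs
  obtain ⟨W, μ, q, hW, hμ, hsum⟩ := h2 L s hL hs P' U ψ₀ hprops
  refine ⟨W, μ, q, hW, hμ, fun H f hf1 hf2 => ⟨_, hlim H f hf1 hf2, ?_⟩⟩
  exact hsum H f hf1 hf2

end Summit.QuantumFields.YangMills.Cruxes.NT.SpectralIdentificationLBirth
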